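import Summits.Ventures.HSemireg.WedgeHankelRecurrenceCauchyIndexEuclid
import Literature.Computability.AlgebraicComplexity.RealTauKnownCases

/-!
# Venture HSemireg — THE CAUCHY INDEX UNDER `x ↦ −x` AND OVER ADJACENT WINDOWS: **`Ind(Q(−x)/P(−x)) = −Ind(Q/P)`** (through the Bezoutian: `B(Q(−X), P(−X)) = −D·B(Q, P)·D`, `D = diag((−1)^i)`,
# a congruence up to sign), **`Ind(Q/P; a, c) = Ind(Q/P; a, b) + Ind(Q/P; b, c)`** for `a ≤ b ≤ c`, `P(b) ≠ 0`, and the window-independence `Ind(Q/P; a, b) = Ind(Q/P; a′, b′)` for two windows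
# containing all real roots of `P` — the elementary calculus of the tree's `cauchyIndex` that N150 ∕ N154 ∕ N156 take for granted

HONEST FRAMING. Part of the Lean index of the computation cell `pub-hsemireg` (seat p10 gen 36, Sunday typer «UNIFORM-IN-n»).
REAL POLYNOMIALS, THE TREE'S CAUCHY INDEX AND BEZOUTIAN MATRICES ONLY (PROVED Literature `Algebra/Polynomial/CauchyIndex` — the public definitions `cauchyIndex`, `cauchyIndexAt` — and
`LinearAlgebra/Matrix/Bezoutian` — `bezCoeff`, `bezoutian` — IMPORTED): no variety, no cohomology theory, no sheaf, no Ext group and no semiregularity map is constructed here; nothing here says that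
HC / HC_CM / HC_AV holds; no Literature fact (unproved `Prop`) is declared or used.  Custodian versions as in `WedgeHankelSiegelIdeal` (1/3).
SOURCE OF THE ARGUMENT (cited; held text read, `book:basu2006-algorithms-real-algebraic-geometry` pp. 66–67): BPR Definition 2.53 (the Cauchy index is a sum of local jumps over the roots in the window —
hence additive over adjacent windows and insensitive to enlarging a window beyond the roots) and the evident behaviour under `x ↦ −x` (every jump changes direction); here the reflection is proved
through N150's `Sign B(Q, P) = Ind(Q/P)` and the coefficient formula of the Bezoutian (Fuhrmann–Helmke, Literature `bezCoeff`): `b_{ij}(p(−X), q(−X)) = (−1)^{i+j+1} b_{ij}(p, q)`.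
DEDUP DISCLOSURE (`rg` of the whole tree + Mathlib, 2026-09-01): Literature `CauchyIndex` ∕ `TarskiQuery` expose `cauchyIndex_mod`, Thm 2.58, Prop 2.57 and Sturm only (their window lemmas are private);
N154 has oddness in `Q`, the Euclid step and the inversion formula; Mathlib has `roots_comp_neg_X`; NO public statement gives additivity over windows, window-independence, the reflection `x ↦ −x` of
the Cauchy index, or the Bezoutian of `(p(−X), q(−X))` — that is this file (`coeff_comp_neg_X` EXISTS in several Literature modules and is imported, not restated).  9 names: 0 hits tree-wide.

WHAT IS IN THE TREE (or staged ahead).  Literature `cauchyIndex P Q a b = Σ_{x ∈ roots_ℝ P, a < x < b} cauchyIndexAt P Q x`, `bezCoeff` (closed form), `bezoutian_apply`; N150 **`sign_bezoutian_eq_cauchyIndex`**;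
N141-style `sigPos ∕ sigNeg_comp_eq_of_surjective` (N126); Literature `DicksonInvariant.toQuadraticForm'_smul`, `QuadraticForm.sigPos_smul_of_neg'`; Mathlib `roots_comp_neg_X`, `natDegree_comp`,
`Finset.filter_filter`, `Finset.sum_union`; Literature `AlgebraicComplexity.coeff_comp_neg_X` (module `RealTauKnownCases`).
THIS FILE (namespace `Summit.Ventures.HSemireg.Wedge.HankelOuter` continued; CHAINED on N154 (hence N150); 0 definitions):
* §794 WINDOWS AND THE BASE CASE: **`cauchyIndex_eq_add_of_eval_ne_zero`** (`a ≤ b ≤ c`, `P(b) ≠ 0`: `Ind(a, c) = Ind(a, b) + Ind(b, c)`), `cauchyIndex_of_le` (`c ≤ a ⇒ Ind(a, c) = 0`),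
  **`cauchyIndex_eq_of_roots_mem`** (two windows containing every real root give the same index), `cauchyIndex_zero_right` (`Ind(0/P) = 0`), **`cauchyIndex_C_right`** (`Ind(b/P) = [deg P odd]·sign(lc P · b)`,
  the base case of BPR's induction, p. 366).
* §795 REFLECTION (`[X^k] p(−X) = (−1)^k p_k` is the PROVED Literature lemma `Literature.Computability.AlgebraicComplexity.coeff_comp_neg_X`, imported): **`bezCoeff_comp_neg_X`** (`b_{ij}(p(−X), q(−X)) = (−1)^{i+j+1} b_{ij}(p, q)`), `bezoutian_comp_neg_X` (`B(p(−X), q(−X)) = −(D B(p,q) D)`,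
  `D = diag((−1)^i)`), `sigPos_sigNeg_bezoutian_comp_neg_X` (the inertia is swapped), **`cauchyIndex_comp_neg_X`** (`P ≠ 0`, `Q = 0 ∨ deg Q < deg P`, roots of `P` in `(lo, hi)`:
  `Ind(Q(−x)/P(−x); −hi, −lo) = −Ind(Q/P; lo, hi)`).
CAVEATS.  `ℝ` only; the reflection statement keeps N150's hypothesis `Q = 0 ∨ deg Q < deg P` (reduce modulo `P` first otherwise) and windows containing all roots (the local, window-by-window
reflection is not typed).
Nothing Ext-side.  New names only.
-/

open Module Polynomial
open scoped Matrix Polynomial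

namespace Summit.Ventures.HSemireg.Wedge.HankelOuter

open Summit.Ventures.HSemireg.Wedge Summit.Ventures.HSemireg.Wedge.Hankel
open Literature.LinearAlgebra.Matrix.Bezoutian (bezCoeff bezoutian bezoutian_apply)
open Literature.Algebra.Polynomial (cauchyIndex cauchyIndexAt)
open Literature.LinearAlgebra.QuadraticForm (sigPos_smul_of_neg' sigNeg_smul_of_neg')
open Literature.LinearAlgebra.QuadraticForm.DicksonInvariant (toQuadraticForm'_smul)
open Literature.Computability.AlgebraicComplexity (coeff_comp_neg_X)

/-! ## §794. Windows -/

/-- **Additivity over adjacent windows: `Ind(Q/P; a, c) = Ind(Q/P; a, b) + Ind(Q/P; b, c)` for `a ≤ b ≤ c` with `P(b) ≠ 0`** (the jumps at the roots in `(a, c)` split at `b`, which is not a root).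
[this file, §794] -/
theorem cauchyIndex_eq_add_of_eval_ne_zero (P Q : ℝ[X]) {a b c : ℝ} (hab : a ≤ b) (hbc : b ≤ c) (hb : P.eval b ≠ 0) :
    cauchyIndex P Q a c = cauchyIndex P Q a b + cauchyIndex P Q b c := by
  classical
  unfold cauchyIndex
  rw [← Finset.sum_union]
  · congr 1
    ext x
    simp only [Finset.mem_union, Finset.mem_filter, Multiset.mem_toFinset]
    constructor
    · rintro ⟨hx, h1, h2⟩
      rcases lt_trichotomy x b with h | h | h
      · exact Or.inl ⟨hx, h1, h⟩
      · exact absurd ((mem_roots (fun h0 => hb (by rw [h0, eval_zero]))).1 hx) (by rw [h]; exact hb)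
      · exact Or.inr ⟨hx, h, h2⟩
    · rintro (⟨hx, h1, h2⟩ | ⟨hx, h1, h2⟩)
      · exact ⟨hx, h1, lt_of_lt_of_le h2 hbc⟩
      · exact ⟨hx, lt_of_le_of_lt hab h1, h2⟩
  · rw [Finset.disjoint_filter]
    intro x _ h1 h2
    exact lt_irrefl _ (h1.2.trans h2.1)

/-- An empty window: `c ≤ a ⇒ Ind(Q/P; a, c) = 0`. [this file, §794] -/
theorem cauchyIndex_of_le (P Q : ℝ[X]) {a c : ℝ} (hca : c ≤ a) : cauchyIndex P Q a c = 0 := by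
  classical
  unfold cauchyIndex
  rw [Finset.filter_false_of_mem fun x _ h => (lt_irrefl _ ((h.1.trans h.2).trans_le hca)).elim, Finset.sum_empty]

/-- **Window independence: two windows containing every real root of `P` give the same Cauchy index.** [this file, §794] -/
theorem cauchyIndex_eq_of_roots_mem (P Q : ℝ[X]) {a b a' b' : ℝ} (h : ∀ x ∈ P.roots, a < x ∧ x < b) (h' : ∀ x ∈ P.roots, a' < x ∧ x < b') :
    cauchyIndex P Q a b = cauchyIndex P Q a' b' := by
  classical
  unfold cauchyIndex
  rw [Finset.filter_true_of_mem fun x hx => h x (Multiset.mem_toFinset.1 hx), Finset.filter_true_of_mem fun x hx => h' x (Multiset.mem_toFinset.1 hx)]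

/-- `Ind(0/P; a, b) = 0` (no jumps: the definition's `Q ≠ 0` guard). [this file, §794] -/
theorem cauchyIndex_zero_right (P : ℝ[X]) (a b : ℝ) : cauchyIndex P 0 a b = 0 := by
  classical
  unfold cauchyIndex
  exact Finset.sum_eq_zero fun x _ => by unfold cauchyIndexAt; rw [if_neg (fun h => h.1 rfl)]

/-- **THE BASE CASE: `Ind(b/P) = [deg P odd] · sign(lc P · b)`** for a non-constant real `P`, a constant `b ≠ 0` and a window containing the real roots of `P` (BPR, proof of Thm. 4.31 ∕ p. 366: «`Ind(b/P) =
sign(a_p b)` if `p` is odd, `0` if `p` is even»; here N154's Euclid step with `P = (b⁻¹P)·b + 0`). [this file, §794] -/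
theorem cauchyIndex_C_right {P : ℝ[X]} (hP : 0 < P.natDegree) {b : ℝ} (hb : b ≠ 0) {lo hi : ℝ} (hroots : ∀ x ∈ P.roots, lo < x ∧ x < hi) :
    cauchyIndex P (C b) lo hi = if Even P.natDegree then 0 else (SignType.sign (P.leadingCoeff * b) : ℤ) := by
  have hdiv : P = (P * C b⁻¹) * C b + 0 := by rw [add_zero, mul_assoc, ← C_mul, inv_mul_cancel₀ hb, C_1, mul_one]
  have h := cauchyIndex_eq_cauchyIndex_neg_add_of_eq_mul_add hdiv (C_ne_zero.2 hb) (Or.inl rfl) (by rw [natDegree_C]; exact hP) hroots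
    (fun x hx => by rw [roots_C] at hx; exact absurd hx (Multiset.notMem_zero x))
  rw [h, neg_zero, cauchyIndex_zero_right, zero_add, natDegree_C, Nat.sub_zero, leadingCoeff_mul, leadingCoeff_C]
  by_cases he : Even P.natDegree
  · rw [if_pos he, if_pos he]
  · rw [if_neg he, if_neg he, show P.leadingCoeff * b⁻¹ = (P.leadingCoeff * b) * (b⁻¹ * b⁻¹) by field_simp, sign_mul, sign_pos (mul_self_pos.2 (inv_ne_zero hb)), mul_one]

/-! ## §795. Reflection `x ↦ −x` -/

/-- **`b_{ij}(p(−X), q(−X)) = (−1)^{i+j+1} · b_{ij}(p, q)`** (Literature's closed form `b_{ij} = Σ_{t ≤ min(i,j)} (q_{i+j+1−t} p_t − p_{i+j+1−t} q_t)`: each term picks up `(−1)^{i+j+1−t} (−1)^t`).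
[this file, §795] -/
theorem bezCoeff_comp_neg_X {R : Type*} [CommRing R] (p q : R[X]) (i j : ℕ) :
    bezCoeff (p.comp (-Polynomial.X)) (q.comp (-Polynomial.X)) i j = (-1) ^ (i + j + 1) * bezCoeff p q i j := by
  unfold bezCoeff
  rw [Finset.mul_sum]
  refine Finset.sum_congr rfl fun t ht => ?_
  have htle : t ≤ i + j + 1 := by have := Finset.mem_range.1 ht; omega
  rw [coeff_comp_neg_X, coeff_comp_neg_X, coeff_comp_neg_X, coeff_comp_neg_X]
  have hpow : ((-1 : R)) ^ (i + j + 1 - t) * (-1) ^ t = (-1) ^ (i + j + 1) := by rw [← pow_add, Nat.sub_add_cancel htle]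
  linear_combination (q.coeff (i + j + 1 - t) * p.coeff t - p.coeff (i + j + 1 - t) * q.coeff t) * hpow

/-- **`B(p(−X), q(−X)) = −(D · B(p, q) · D)`** with `D = diag((−1)^i)`. [this file, §795] -/
theorem bezoutian_comp_neg_X {R : Type*} [CommRing R] (n : ℕ) (p q : R[X]) :
    bezoutian n (p.comp (-Polynomial.X)) (q.comp (-Polynomial.X))
      = -(Matrix.diagonal (fun i : Fin n => ((-1 : R)) ^ (i : ℕ)) * bezoutian n p q * Matrix.diagonal (fun i : Fin n => ((-1 : R)) ^ (i : ℕ))) := by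
  ext i j
  rw [bezoutian_apply, bezCoeff_comp_neg_X, Matrix.neg_apply, Matrix.mul_diagonal, Matrix.diagonal_mul, bezoutian_apply]
  ring

section Ordered

variable {K : Type*} [Field K] [LinearOrder K] [IsStrictOrderedRing K]

/-- **The inertia of `B(p(−X), q(−X))` is the SWAPPED inertia of `B(p, q)`** (`−(D B D)` with `D = Dᵀ`, `D² = 1`: a congruence followed by a sign change; any linearly ordered field). [this file, §795] -/
theorem sigPos_sigNeg_bezoutian_comp_neg_X (n : ℕ) (p q : K[X]) :
    sigPos (bezoutian n (p.comp (-Polynomial.X)) (q.comp (-Polynomial.X))).toQuadraticForm' = sigNeg (bezoutian n p q).toQuadraticForm'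
      ∧ sigNeg (bezoutian n (p.comp (-Polynomial.X)) (q.comp (-Polynomial.X))).toQuadraticForm' = sigPos (bezoutian n p q).toQuadraticForm' := by
  set D : Matrix (Fin n) (Fin n) K := Matrix.diagonal fun i : Fin n => ((-1 : K)) ^ (i : ℕ) with hD
  have hDT : Dᵀ = D := Matrix.diagonal_transpose _
  have hDD : D * D = 1 := by
    rw [hD, Matrix.diagonal_mul_diagonal, ← Matrix.diagonal_one]
    congr 1
    funext i
    rw [← pow_add, ← two_mul, pow_mul, neg_one_sq, one_pow]
  have hsurj : Function.Surjective (Matrix.toLin' D) := fun w => ⟨D *ᵥ w, by rw [Matrix.toLin'_apply, Matrix.mulVec_mulVec, hDD, Matrix.one_mulVec]⟩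
  have hneg : -(D * bezoutian n p q * D) = (-1 : K) • (Dᵀ * bezoutian n p q * D) := by rw [hDT, neg_one_smul]
  have h1 : (-1 : K) < 0 := by norm_num
  rw [bezoutian_comp_neg_X, ← hD, hneg, toQuadraticForm'_smul, Literature.LinearAlgebra.QuadraticForm.DeterminantCharTwo.toQuadraticForm'_transpose_mul_mul, sigPos_smul_of_neg' _ h1,
    sigNeg_smul_of_neg' _ h1, sigNeg_comp_eq_of_surjective _ hsurj, sigPos_comp_eq_of_surjective _ hsurj]
  exact ⟨rfl, rfl⟩

end Ordered

/-- **REFLECTION: `Ind(Q(−x)/P(−x); −hi, −lo) = −Ind(Q/P; lo, hi)`** for `P ≠ 0`, `Q = 0 ∨ deg Q < deg P` and a window `(lo, hi)` containing the real roots of `P` (so `(−hi, −lo)` contains those of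
`P(−X)`, Mathlib `roots_comp_neg_X`): both sides are Bezoutian signatures by N150, and the Bezoutian of the reflected pair has the swapped inertia. [this file, §795] -/
theorem cauchyIndex_comp_neg_X (P Q : ℝ[X]) (hP : P ≠ 0) (hPQ : Q = 0 ∨ Q.natDegree < P.natDegree) {lo hi : ℝ} (hroots : ∀ x ∈ P.roots, lo < x ∧ x < hi) :
    cauchyIndex (P.comp (-Polynomial.X)) (Q.comp (-Polynomial.X)) (-hi) (-lo) = -cauchyIndex P Q lo hi := by
  have hX : (-Polynomial.X : ℝ[X]).natDegree = 1 := by rw [natDegree_neg, natDegree_X]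
  have hdP : (P.comp (-Polynomial.X)).natDegree = P.natDegree := by rw [natDegree_comp, hX, mul_one]
  have hdQ : (Q.comp (-Polynomial.X)).natDegree = Q.natDegree := by rw [natDegree_comp, hX, mul_one]
  have hP' : P.comp (-Polynomial.X) ≠ 0 := fun h => by
    have hl := comp_neg_X_leadingCoeff_eq P
    rw [h, leadingCoeff_zero] at hl
    exact (mul_ne_zero (pow_ne_zero _ (neg_ne_zero.2 one_ne_zero)) (leadingCoeff_ne_zero.2 hP)) hl.symm
  have hPQ' : Q.comp (-Polynomial.X) = 0 ∨ (Q.comp (-Polynomial.X)).natDegree < (P.comp (-Polynomial.X)).natDegree := by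
    rcases hPQ with h | h
    · exact Or.inl (by rw [h, zero_comp])
    · exact Or.inr (by rw [hdQ, hdP]; exact h)
  have hroots' : ∀ x ∈ (P.comp (-Polynomial.X)).roots, -hi < x ∧ x < -lo := by
    intro x hx
    rw [roots_comp_neg_X, Multiset.mem_map] at hx
    obtain ⟨y, hy, rfl⟩ := hx
    have h := hroots y hy
    exact ⟨by linarith [h.2], by linarith [h.1]⟩
  rw [← sign_bezoutian_eq_cauchyIndex _ _ hP' hPQ' hroots', ← sign_bezoutian_eq_cauchyIndex P Q hP hPQ hroots, hdP]
  obtain ⟨h1, h2⟩ := sigPos_sigNeg_bezoutian_comp_neg_X (K := ℝ) P.natDegree Q P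
  rw [h1, h2]
  ring

end Summit.Ventures.HSemireg.Wedge.HankelOuter
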